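import Summits.ABC.IUTFork.LDHGenuineUnionPrintIsm
import Summits.ABC.IUTFork.Conditional.AbcOfSCor312OfInhabited
import Summits.ABC.IUTFork.LDHGenuinePerImageFreyRowsA
import Summits.ABC.IUTFork.LDHGenuinePerImageFreyRowsB
import Mathlib.Analysis.Complex.ExponentialBounds
import HarnessLib

/-!
# The fork at [IUTchIII] Corollary 3.12, L-DH level, over PRINT's (Ind2): the remaining §S rational carriers of the census —
# `7³ + 3¹⁰ = 2¹¹·29` (`l = 29`), `1 + 3¹⁶7 = 2³11·23·53³` (`l = 23`), the 73-triple `73 + 2¹³7⁷941²` (`l = 73, 127`): datum types INHABITED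
# (abc-iut-C-cert-3 junctions) and BOTH readings (P), (U) with Θ-side over print's factorwise `Ism` FAIL for every datum
# (abc-iut cell, crux ThetaPartII = stmt-ABC-19678; row «C:PERIMAGE-PRINT-ISM», part 8)

Record-only PROOF file (D-0012; no definition, no `Prop` fact) of the abc-iut cell (WAVE-3 discharge seat abc-iut-c312-d1, gen 11; sequel of parts 2, 4, 5, 6).
TAKES NO SIDE on [IUTchIII] Cor. 3.12. With part 4/6 (283-triple × 73 levels, Reyssat/13) and part 3 (Broberg/7,/11) this covers EVERY carrier of
abc-iut-C-cert-3's «(U) OVER INHABITED TYPES» junction `Conditional/AbcOfSCor312OfInhabited` except the HEX family (whose exact `log q^{∤2l}` is not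
in the tree; by part 7's criterion the print-Ism readings there are TRUE exactly at the shallow rows).

* `FreyA.twentyfour_le_logQAvoid_pair'` (`λ = 343/59392`, `l = 29`: `20·log 3 + 6·log 7 ≥ 24`), `FreyC.…` (`λ = 1/301327048`, `l = 23`),
  `FreyF.…` (`λ = 73/5973865915867209`, `l = 73, 127`) — this lineage's exact values BY NAME, `log 3 > 1`;
* **`Frey343.nonempty_and_not_printInd2_twentyNine`**, **`Frey301327048.nonempty_and_not_printInd2_twentyThree`**,
  **`Frey73.nonempty_and_not_printInd2_tabulated`** (`l ∈ {73, 127}`): datum type INHABITED (C-cert-3's `….nonempty_and_cor312Of_…`, by name) ∧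
  for every datum and every print-dominated `H`, the (P)-inequality AND the (U)-inequality over print's (Ind2) FAIL — while the container reading
  (U) `T.Cor312Of` holds there (same junctions).

READING (numbers about OUR typed objects): every rational (triple, l) row of the cell's inhabited-type census is now DECIDED for the print-Ism (Ind2)
reading in kernel: FALSE at all §S rows (log q^{∤2l} ≥ 24), by the side of the container reading holding. Decided- or refuted-as-typed ≠ in print;
(Ind1) strip part (row «C:PERIMAGE-PRINT-IND1», abc-iut-c312-1), (Ind3), the log-link, Cor. 3.12 itself untouched; no height bound follows; nothing
here asserts that abc is proved or refuted; no side taken. [cite: Mochizuki2012, IUTchIII Cor. 3.12 p. 173–174; Thm. 3.11 (i) p. 154]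
[cite: Mochizuki2012, IUTchIV Thm. 1.10 p. 23; Cor. 2.2 (ii) proof (P6)(P7) p. 46] [cite: DupuyHilado2025, §4.7, §4.9, §4.12]
[claim: Mochizuki2012, status: disputed] for every IUT quotation. Axioms: standard three.
-/

noncomputable section

open NumberField IsDedekindDomain

namespace Literature.IUT.LogVolume.Cor22

open Summit.ABC.IUTFork Summit.ABC.IUTFork.Thm311.Real Literature.NumberTheory.NumberFields
open Literature.NumberTheory.DiophantineGeometry Literature.NumberTheory.DiophantineGeometry.GenEll

/-- `1 < log 3` and monotone comparisons used below (`e < 2.72 < 3`). [folklore] -/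
private theorem log_three_bounds :
    (1 : ℝ) < Real.log 3 ∧ Real.log 3 ≤ Real.log 7 ∧ Real.log 3 ≤ Real.log 11 ∧ Real.log 3 ≤ Real.log 53 ∧
      Real.log 3 ≤ Real.log 73 ∧ Real.log 3 ≤ Real.log 103 ∧ Real.log 3 ≤ Real.log 127 ∧ Real.log 3 ≤ Real.log 941 := by
  refine ⟨?_, Real.log_le_log (by norm_num) (by norm_num), Real.log_le_log (by norm_num) (by norm_num),
    Real.log_le_log (by norm_num) (by norm_num), Real.log_le_log (by norm_num) (by norm_num),
    Real.log_le_log (by norm_num) (by norm_num), Real.log_le_log (by norm_num) (by norm_num),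
    Real.log_le_log (by norm_num) (by norm_num)⟩
  rw [Real.lt_log_iff_exp_lt (by norm_num)]
  have := Real.exp_one_lt_d9
  linarith

/-! ## 1. `7³ + 3¹⁰ = 2¹¹·29` (`λ = 343/59392`), `l = 29` -/

namespace Frey343

/-- `log q^{∤{2,29}}(343/59392) = 20·log 3 + 6·log 7 ≥ 24` (carrier spelling of the junction). [cite: Mochizuki2012, IUTchIV Thm. 1.10 p. 23]
[claim: Mochizuki2012, status: disputed] -/
theorem twentyfour_le_logQAvoid_pair' : 24 ≤ logQAvoid (ratPoint (((343 : ℕ) : ℚ) / (59392 : ℕ))) {2, 29} := by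
  have hq : (((343 : ℕ) : ℚ) / (59392 : ℕ)) = ((343 : ℚ) / 59392) := by norm_num
  obtain ⟨h3, h7, -, -, -, -, -, -⟩ := log_three_bounds
  rw [hq, logQAvoid_freyA_twentynine]; linarith

/-- **`7³ + 3¹⁰ = 2¹¹·29` at `l = 29`: INHABITED (abc-iut-C-cert-3 `Frey343.nonempty_and_cor312Of_twentyNine`) ∧ for every datum and every
print-dominated `H` the (P)-inequality over PRINT's (Ind2) FAILS.** [cite: Mochizuki2012, IUTchIII Cor. 3.12 p. 173–174] [claim: Mochizuki2012, status: disputed] -/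
theorem nonempty_and_not_perImage_printInd2_twentyNine :
    Nonempty (ThetaVolumeDatumAt (ratPoint (((343 : ℕ) : ℚ) / (59392 : ℕ))) 29) ∧
    ∀ T : ThetaVolumeDatumAt (ratPoint (((343 : ℕ) : ℚ) / (59392 : ℕ))) 29,
    letI := T.instFieldF; letI := T.instNumberFieldF; letI := T.instFieldK; letI := T.instNumberFieldK
    letI := T.instAlgebraK; letI := T.instIsElliptic
    ∀ (H : (p : ℕ) → (hp : p.Prime) → (j : ℕ) →
        (e : Fin (j + 1) → placesOver (Literature.IUT.HodgeTheaters.fieldOfModuli T.E) p) →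
        haveI : Fact p.Prime := ⟨hp⟩
        Subgroup (PacketAlgebra p (fun b => (T.I.σ.localFields p).k (e b)) ≃ₗ[ℚ_[p]]
          PacketAlgebra p (fun b => (T.I.σ.localFields p).k (e b)))),
      (∀ (p : ℕ) (hp : p.Prime), haveI : Fact p.Prime := ⟨hp⟩
        ∀ j e, ∀ g ∈ H p hp j e,
          ∃ ψ : ∀ b : Fin (j + 1), Carrier (.inr (T.I.σ.lift (e b).1) : Thm311.Real.Place T.K) ≃ₗ[ℚ]
              Carrier (.inr (T.I.σ.lift (e b).1) : Thm311.Real.Place T.K),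
            (∀ b, ψ b ∈ ismIsm (analyticLogv T.K) (T.I.σ.lift (e b).1)) ∧
            ∀ x : ∀ b, (T.I.σ.localFields p).k (e b),
              (g : PacketAlgebra p (fun b => (T.I.σ.localFields p).k (e b)) ≃ₗ[ℚ_[p]]
                  PacketAlgebra p (fun b => (T.I.σ.localFields p).k (e b))) (PiTensorProduct.tprod ℚ_[p] x) =
                PiTensorProduct.tprod ℚ_[p] (fun b =>
                  RescaledCompletion.of T.K p (T.I.σ.lift (e b).1) (T.I.σ.natCast_mem_lift (e b))
                    (ψ b ((RescaledCompletion.of T.K p (T.I.σ.lift (e b).1) (T.I.σ.natCast_mem_lift (e b))).symm (x b))))) →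
      ¬ (T.negAbsLogQ ≤
          (∑ p ∈ T.I.supportPrimes,
            if hp : p.Prime then
              (haveI : Fact p.Prime := ⟨hp⟩
               (T.I.packetAt p hp).lnνLp T.I.lstar (fun j e =>
                 packetHull p (fun b => (T.I.σ.localFields p).k (e b))
                   (⋃ g : H p hp j e, (g : PacketAlgebra p (fun b => (T.I.σ.localFields p).k (e b)) ≃ₗ[ℚ_[p]]
                       PacketAlgebra p (fun b => (T.I.σ.localFields p).k (e b))) ''
                     (T.I.packetAt p hp).pilotRegion (T.I.tΘ p hp) j e)))
            else 0) + ThetaVolumeInput.archLogTheta 29) :=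
  ⟨Conditional.Frey343.nonempty_and_cor312Of_twentyNine.1, fun T =>
    T.not_perImage_printInd2_of_le (ratPoint_mem_UPle_one (by norm_num) (by norm_num)).1.1 (by norm_num)
      twentyfour_le_logQAvoid_pair'⟩

/-- **… and the (U)-inequality over PRINT's (Ind2) FAILS there too** (rational `j`: part 5's `not_union_printInd2_ratPoint`), while the container
reading (U) `T.Cor312Of` holds (same junction). [cite: Mochizuki2012, IUTchIII Cor. 3.12 p. 174] [claim: Mochizuki2012, status: disputed] -/
theorem nonempty_and_not_union_printInd2_twentyNine :
    Nonempty (ThetaVolumeDatumAt (ratPoint (((343 : ℕ) : ℚ) / (59392 : ℕ))) 29) ∧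
    ∀ T : ThetaVolumeDatumAt (ratPoint (((343 : ℕ) : ℚ) / (59392 : ℕ))) 29,
    letI := T.instFieldF; letI := T.instNumberFieldF; letI := T.instFieldK; letI := T.instNumberFieldK
    letI := T.instAlgebraK; letI := T.instIsElliptic
    ∀ (H : (p : ℕ) → (hp : p.Prime) → (j : ℕ) →
        (e : Fin (j + 1) → placesOver (Literature.IUT.HodgeTheaters.fieldOfModuli T.E) p) →
        haveI : Fact p.Prime := ⟨hp⟩
        Subgroup (PacketAlgebra p (fun b => (T.I.σ.localFields p).k (e b)) ≃ₗ[ℚ_[p]]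
          PacketAlgebra p (fun b => (T.I.σ.localFields p).k (e b)))),
      (∀ (p : ℕ) (hp : p.Prime), haveI : Fact p.Prime := ⟨hp⟩
        ∀ j e, ∀ g ∈ H p hp j e,
          ∃ ψ : ∀ b : Fin (j + 1), Carrier (.inr (T.I.σ.lift (e b).1) : Thm311.Real.Place T.K) ≃ₗ[ℚ]
              Carrier (.inr (T.I.σ.lift (e b).1) : Thm311.Real.Place T.K),
            (∀ b, ψ b ∈ ismIsm (analyticLogv T.K) (T.I.σ.lift (e b).1)) ∧
            ∀ x : ∀ b, (T.I.σ.localFields p).k (e b),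
              (g : PacketAlgebra p (fun b => (T.I.σ.localFields p).k (e b)) ≃ₗ[ℚ_[p]]
                  PacketAlgebra p (fun b => (T.I.σ.localFields p).k (e b))) (PiTensorProduct.tprod ℚ_[p] x) =
                PiTensorProduct.tprod ℚ_[p] (fun b =>
                  RescaledCompletion.of T.K p (T.I.σ.lift (e b).1) (T.I.σ.natCast_mem_lift (e b))
                    (ψ b ((RescaledCompletion.of T.K p (T.I.σ.lift (e b).1) (T.I.σ.natCast_mem_lift (e b))).symm (x b))))) →
      ¬ (T.negAbsLogQ ≤
          (∑ p ∈ T.I.supportPrimes,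
            if hp : p.Prime then
              (haveI : Fact p.Prime := ⟨hp⟩
               (T.I.packetAt p hp).lnνLp T.I.lstar (fun j e =>
                 packetHull p (fun b => (T.I.σ.localFields p).k (e b))
                   (⋃ g : H p hp j e, (g : PacketAlgebra p (fun b => (T.I.σ.localFields p).k (e b)) ≃ₗ[ℚ_[p]]
                       PacketAlgebra p (fun b => (T.I.σ.localFields p).k (e b))) ''
                     ⋃ τ : Equiv.Perm (Fin (j + 1)), (T.I.packetAt p hp).perm τ e ''
                       (T.I.packetAt p hp).pilotRegion (T.I.tΘ p hp) j (e ∘ τ))))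
            else 0) + ThetaVolumeInput.archLogTheta 29) :=
  ⟨Conditional.Frey343.nonempty_and_cor312Of_twentyNine.1, fun T =>
    T.not_union_printInd2_ratPoint (by norm_num) (by norm_num) (by norm_num) twentyfour_le_logQAvoid_pair'⟩

end Frey343

/-! ## 2. `1 + 3¹⁶·7 = 2³·11·23·53³` (`λ = 1/301327048`), `l = 23` -/

namespace Frey301327048

/-- `log q^{∤{2,23}}(1/301327048) = 32·log 3 + 2·log 7 + 2·log 11 + 6·log 53 ≥ 24`. [cite: Mochizuki2012, IUTchIV Thm. 1.10 p. 23]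
[claim: Mochizuki2012, status: disputed] -/
theorem twentyfour_le_logQAvoid_pair' : 24 ≤ logQAvoid (ratPoint (((1 : ℕ) : ℚ) / (301327048 : ℕ))) {2, 23} := by
  have hq : (((1 : ℕ) : ℚ) / (301327048 : ℕ)) = ((1 : ℚ) / 301327048) := by norm_num
  obtain ⟨h3, h7, h11, h53, -, -, -, -⟩ := log_three_bounds
  rw [hq, logQAvoid_freyC_twentythree]; linarith

/-- **`1 + 3¹⁶7 = 2³11·23·53³` at `l = 23`: INHABITED (abc-iut-C-cert-3 `Frey301327048.nonempty_and_cor312Of_twentyThree`) ∧ the (P)-inequality over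
PRINT's (Ind2) FAILS for every datum and every print-dominated `H`.** [cite: Mochizuki2012, IUTchIII Cor. 3.12 p. 173–174] [claim: Mochizuki2012, status: disputed] -/
theorem nonempty_and_not_perImage_printInd2_twentyThree :
    Nonempty (ThetaVolumeDatumAt (ratPoint (((1 : ℕ) : ℚ) / (301327048 : ℕ))) 23) ∧
    ∀ T : ThetaVolumeDatumAt (ratPoint (((1 : ℕ) : ℚ) / (301327048 : ℕ))) 23,
    letI := T.instFieldF; letI := T.instNumberFieldF; letI := T.instFieldK; letI := T.instNumberFieldK
    letI := T.instAlgebraK; letI := T.instIsElliptic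
    ∀ (H : (p : ℕ) → (hp : p.Prime) → (j : ℕ) →
        (e : Fin (j + 1) → placesOver (Literature.IUT.HodgeTheaters.fieldOfModuli T.E) p) →
        haveI : Fact p.Prime := ⟨hp⟩
        Subgroup (PacketAlgebra p (fun b => (T.I.σ.localFields p).k (e b)) ≃ₗ[ℚ_[p]]
          PacketAlgebra p (fun b => (T.I.σ.localFields p).k (e b)))),
      (∀ (p : ℕ) (hp : p.Prime), haveI : Fact p.Prime := ⟨hp⟩
        ∀ j e, ∀ g ∈ H p hp j e,
          ∃ ψ : ∀ b : Fin (j + 1), Carrier (.inr (T.I.σ.lift (e b).1) : Thm311.Real.Place T.K) ≃ₗ[ℚ]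
              Carrier (.inr (T.I.σ.lift (e b).1) : Thm311.Real.Place T.K),
            (∀ b, ψ b ∈ ismIsm (analyticLogv T.K) (T.I.σ.lift (e b).1)) ∧
            ∀ x : ∀ b, (T.I.σ.localFields p).k (e b),
              (g : PacketAlgebra p (fun b => (T.I.σ.localFields p).k (e b)) ≃ₗ[ℚ_[p]]
                  PacketAlgebra p (fun b => (T.I.σ.localFields p).k (e b))) (PiTensorProduct.tprod ℚ_[p] x) =
                PiTensorProduct.tprod ℚ_[p] (fun b =>
                  RescaledCompletion.of T.K p (T.I.σ.lift (e b).1) (T.I.σ.natCast_mem_lift (e b))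
                    (ψ b ((RescaledCompletion.of T.K p (T.I.σ.lift (e b).1) (T.I.σ.natCast_mem_lift (e b))).symm (x b))))) →
      ¬ (T.negAbsLogQ ≤
          (∑ p ∈ T.I.supportPrimes,
            if hp : p.Prime then
              (haveI : Fact p.Prime := ⟨hp⟩
               (T.I.packetAt p hp).lnνLp T.I.lstar (fun j e =>
                 packetHull p (fun b => (T.I.σ.localFields p).k (e b))
                   (⋃ g : H p hp j e, (g : PacketAlgebra p (fun b => (T.I.σ.localFields p).k (e b)) ≃ₗ[ℚ_[p]]
                       PacketAlgebra p (fun b => (T.I.σ.localFields p).k (e b))) ''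
                     (T.I.packetAt p hp).pilotRegion (T.I.tΘ p hp) j e)))
            else 0) + ThetaVolumeInput.archLogTheta 23) :=
  ⟨Conditional.Frey301327048.nonempty_and_cor312Of_twentyThree.1, fun T =>
    T.not_perImage_printInd2_of_le (ratPoint_mem_UPle_one (by norm_num) (by norm_num)).1.1 (by norm_num)
      twentyfour_le_logQAvoid_pair'⟩

/-- **… and the (U)-inequality over PRINT's (Ind2) FAILS there too.** [cite: Mochizuki2012, IUTchIII Cor. 3.12 p. 174] [claim: Mochizuki2012, status: disputed] -/
theorem nonempty_and_not_union_printInd2_twentyThree :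
    Nonempty (ThetaVolumeDatumAt (ratPoint (((1 : ℕ) : ℚ) / (301327048 : ℕ))) 23) ∧
    ∀ T : ThetaVolumeDatumAt (ratPoint (((1 : ℕ) : ℚ) / (301327048 : ℕ))) 23,
    letI := T.instFieldF; letI := T.instNumberFieldF; letI := T.instFieldK; letI := T.instNumberFieldK
    letI := T.instAlgebraK; letI := T.instIsElliptic
    ∀ (H : (p : ℕ) → (hp : p.Prime) → (j : ℕ) →
        (e : Fin (j + 1) → placesOver (Literature.IUT.HodgeTheaters.fieldOfModuli T.E) p) →
        haveI : Fact p.Prime := ⟨hp⟩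
        Subgroup (PacketAlgebra p (fun b => (T.I.σ.localFields p).k (e b)) ≃ₗ[ℚ_[p]]
          PacketAlgebra p (fun b => (T.I.σ.localFields p).k (e b)))),
      (∀ (p : ℕ) (hp : p.Prime), haveI : Fact p.Prime := ⟨hp⟩
        ∀ j e, ∀ g ∈ H p hp j e,
          ∃ ψ : ∀ b : Fin (j + 1), Carrier (.inr (T.I.σ.lift (e b).1) : Thm311.Real.Place T.K) ≃ₗ[ℚ]
              Carrier (.inr (T.I.σ.lift (e b).1) : Thm311.Real.Place T.K),
            (∀ b, ψ b ∈ ismIsm (analyticLogv T.K) (T.I.σ.lift (e b).1)) ∧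
            ∀ x : ∀ b, (T.I.σ.localFields p).k (e b),
              (g : PacketAlgebra p (fun b => (T.I.σ.localFields p).k (e b)) ≃ₗ[ℚ_[p]]
                  PacketAlgebra p (fun b => (T.I.σ.localFields p).k (e b))) (PiTensorProduct.tprod ℚ_[p] x) =
                PiTensorProduct.tprod ℚ_[p] (fun b =>
                  RescaledCompletion.of T.K p (T.I.σ.lift (e b).1) (T.I.σ.natCast_mem_lift (e b))
                    (ψ b ((RescaledCompletion.of T.K p (T.I.σ.lift (e b).1) (T.I.σ.natCast_mem_lift (e b))).symm (x b))))) →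
      ¬ (T.negAbsLogQ ≤
          (∑ p ∈ T.I.supportPrimes,
            if hp : p.Prime then
              (haveI : Fact p.Prime := ⟨hp⟩
               (T.I.packetAt p hp).lnνLp T.I.lstar (fun j e =>
                 packetHull p (fun b => (T.I.σ.localFields p).k (e b))
                   (⋃ g : H p hp j e, (g : PacketAlgebra p (fun b => (T.I.σ.localFields p).k (e b)) ≃ₗ[ℚ_[p]]
                       PacketAlgebra p (fun b => (T.I.σ.localFields p).k (e b))) ''
                     ⋃ τ : Equiv.Perm (Fin (j + 1)), (T.I.packetAt p hp).perm τ e ''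
                       (T.I.packetAt p hp).pilotRegion (T.I.tΘ p hp) j (e ∘ τ))))
            else 0) + ThetaVolumeInput.archLogTheta 23) :=
  ⟨Conditional.Frey301327048.nonempty_and_cor312Of_twentyThree.1, fun T =>
    T.not_union_printInd2_ratPoint (by norm_num) (by norm_num) (by norm_num) twentyfour_le_logQAvoid_pair'⟩

end Frey301327048

/-! ## 3. The 73-triple `73 + 2¹³·7⁷·941²` (`λ = 73/5973865915867209`), `l ∈ {73, 127}` -/

namespace Frey73

/-- `log q^{∤{2,l}}(73/5973865915867209) ≥ 24` at the two tabulated levels `l = 73, 127` (exact values of this lineage by name).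
[cite: Mochizuki2012, IUTchIV Thm. 1.10 p. 23] [claim: Mochizuki2012, status: disputed] -/
theorem twentyfour_le_logQAvoid_pair' {l : ℕ} (hl : l = 73 ∨ l = 127) :
    24 ≤ logQAvoid (ratPoint (((73 : ℕ) : ℚ) / (5973865915867209 : ℕ))) {2, l} := by
  have hq : (((73 : ℕ) : ℚ) / (5973865915867209 : ℕ)) = ((73 : ℚ) / 5973865915867209) := by norm_num
  obtain ⟨h3, h7, -, -, h73, h103, h127, h941⟩ := log_three_bounds
  rw [hq]
  rcases hl with rfl | rfl
  · rw [logQAvoid_freyF_seventythree]; linarith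
  · rw [logQAvoid_freyF_onetwentyseven]; linarith

/-- **The 73-triple at its tabulated levels `l ∈ {73, 127}`: INHABITED (abc-iut-C-cert-3 `Frey73.nonempty_and_cor312Of_tabulated`) ∧ the
(P)-inequality over PRINT's (Ind2) FAILS for every datum and every print-dominated `H`.** [cite: Mochizuki2012, IUTchIII Cor. 3.12 p. 173–174]
[claim: Mochizuki2012, status: disputed] -/
theorem nonempty_and_not_perImage_printInd2_tabulated :
    ∀ l ∈ ([73, 127] : List ℕ),
    Nonempty (ThetaVolumeDatumAt (ratPoint (((73 : ℕ) : ℚ) / (5973865915867209 : ℕ))) l) ∧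
    ∀ T : ThetaVolumeDatumAt (ratPoint (((73 : ℕ) : ℚ) / (5973865915867209 : ℕ))) l,
    letI := T.instFieldF; letI := T.instNumberFieldF; letI := T.instFieldK; letI := T.instNumberFieldK
    letI := T.instAlgebraK; letI := T.instIsElliptic
    ∀ (H : (p : ℕ) → (hp : p.Prime) → (j : ℕ) →
        (e : Fin (j + 1) → placesOver (Literature.IUT.HodgeTheaters.fieldOfModuli T.E) p) →
        haveI : Fact p.Prime := ⟨hp⟩
        Subgroup (PacketAlgebra p (fun b => (T.I.σ.localFields p).k (e b)) ≃ₗ[ℚ_[p]]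
          PacketAlgebra p (fun b => (T.I.σ.localFields p).k (e b)))),
      (∀ (p : ℕ) (hp : p.Prime), haveI : Fact p.Prime := ⟨hp⟩
        ∀ j e, ∀ g ∈ H p hp j e,
          ∃ ψ : ∀ b : Fin (j + 1), Carrier (.inr (T.I.σ.lift (e b).1) : Thm311.Real.Place T.K) ≃ₗ[ℚ]
              Carrier (.inr (T.I.σ.lift (e b).1) : Thm311.Real.Place T.K),
            (∀ b, ψ b ∈ ismIsm (analyticLogv T.K) (T.I.σ.lift (e b).1)) ∧
            ∀ x : ∀ b, (T.I.σ.localFields p).k (e b),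
              (g : PacketAlgebra p (fun b => (T.I.σ.localFields p).k (e b)) ≃ₗ[ℚ_[p]]
                  PacketAlgebra p (fun b => (T.I.σ.localFields p).k (e b))) (PiTensorProduct.tprod ℚ_[p] x) =
                PiTensorProduct.tprod ℚ_[p] (fun b =>
                  RescaledCompletion.of T.K p (T.I.σ.lift (e b).1) (T.I.σ.natCast_mem_lift (e b))
                    (ψ b ((RescaledCompletion.of T.K p (T.I.σ.lift (e b).1) (T.I.σ.natCast_mem_lift (e b))).symm (x b))))) →
      ¬ (T.negAbsLogQ ≤
          (∑ p ∈ T.I.supportPrimes,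
            if hp : p.Prime then
              (haveI : Fact p.Prime := ⟨hp⟩
               (T.I.packetAt p hp).lnνLp T.I.lstar (fun j e =>
                 packetHull p (fun b => (T.I.σ.localFields p).k (e b))
                   (⋃ g : H p hp j e, (g : PacketAlgebra p (fun b => (T.I.σ.localFields p).k (e b)) ≃ₗ[ℚ_[p]]
                       PacketAlgebra p (fun b => (T.I.σ.localFields p).k (e b))) ''
                     (T.I.packetAt p hp).pilotRegion (T.I.tΘ p hp) j e)))
            else 0) + ThetaVolumeInput.archLogTheta l) := by
  intro l hl
  have hside : ∀ l ∈ ([73, 127] : List ℕ), (l = 73 ∨ l = 127) ∧ 5 ≤ l := by decide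
  exact ⟨(Conditional.Frey73.nonempty_and_cor312Of_tabulated l hl).1, fun T =>
    T.not_perImage_printInd2_of_le (ratPoint_mem_UPle_one (by norm_num) (by norm_num)).1.1 (hside l hl).2
      (twentyfour_le_logQAvoid_pair' (hside l hl).1)⟩

/-- **… and the (U)-inequality over PRINT's (Ind2) FAILS there too.** [cite: Mochizuki2012, IUTchIII Cor. 3.12 p. 174] [claim: Mochizuki2012, status: disputed] -/
theorem nonempty_and_not_union_printInd2_tabulated :
    ∀ l ∈ ([73, 127] : List ℕ),
    Nonempty (ThetaVolumeDatumAt (ratPoint (((73 : ℕ) : ℚ) / (5973865915867209 : ℕ))) l) ∧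
    ∀ T : ThetaVolumeDatumAt (ratPoint (((73 : ℕ) : ℚ) / (5973865915867209 : ℕ))) l,
    letI := T.instFieldF; letI := T.instNumberFieldF; letI := T.instFieldK; letI := T.instNumberFieldK
    letI := T.instAlgebraK; letI := T.instIsElliptic
    ∀ (H : (p : ℕ) → (hp : p.Prime) → (j : ℕ) →
        (e : Fin (j + 1) → placesOver (Literature.IUT.HodgeTheaters.fieldOfModuli T.E) p) →
        haveI : Fact p.Prime := ⟨hp⟩
        Subgroup (PacketAlgebra p (fun b => (T.I.σ.localFields p).k (e b)) ≃ₗ[ℚ_[p]]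
          PacketAlgebra p (fun b => (T.I.σ.localFields p).k (e b)))),
      (∀ (p : ℕ) (hp : p.Prime), haveI : Fact p.Prime := ⟨hp⟩
        ∀ j e, ∀ g ∈ H p hp j e,
          ∃ ψ : ∀ b : Fin (j + 1), Carrier (.inr (T.I.σ.lift (e b).1) : Thm311.Real.Place T.K) ≃ₗ[ℚ]
              Carrier (.inr (T.I.σ.lift (e b).1) : Thm311.Real.Place T.K),
            (∀ b, ψ b ∈ ismIsm (analyticLogv T.K) (T.I.σ.lift (e b).1)) ∧
            ∀ x : ∀ b, (T.I.σ.localFields p).k (e b),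
              (g : PacketAlgebra p (fun b => (T.I.σ.localFields p).k (e b)) ≃ₗ[ℚ_[p]]
                  PacketAlgebra p (fun b => (T.I.σ.localFields p).k (e b))) (PiTensorProduct.tprod ℚ_[p] x) =
                PiTensorProduct.tprod ℚ_[p] (fun b =>
                  RescaledCompletion.of T.K p (T.I.σ.lift (e b).1) (T.I.σ.natCast_mem_lift (e b))
                    (ψ b ((RescaledCompletion.of T.K p (T.I.σ.lift (e b).1) (T.I.σ.natCast_mem_lift (e b))).symm (x b))))) →
      ¬ (T.negAbsLogQ ≤
          (∑ p ∈ T.I.supportPrimes,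
            if hp : p.Prime then
              (haveI : Fact p.Prime := ⟨hp⟩
               (T.I.packetAt p hp).lnνLp T.I.lstar (fun j e =>
                 packetHull p (fun b => (T.I.σ.localFields p).k (e b))
                   (⋃ g : H p hp j e, (g : PacketAlgebra p (fun b => (T.I.σ.localFields p).k (e b)) ≃ₗ[ℚ_[p]]
                       PacketAlgebra p (fun b => (T.I.σ.localFields p).k (e b))) ''
                     ⋃ τ : Equiv.Perm (Fin (j + 1)), (T.I.packetAt p hp).perm τ e ''
                       (T.I.packetAt p hp).pilotRegion (T.I.tΘ p hp) j (e ∘ τ))))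
            else 0) + ThetaVolumeInput.archLogTheta l) := by
  intro l hl
  have hside : ∀ l ∈ ([73, 127] : List ℕ), (l = 73 ∨ l = 127) ∧ 5 ≤ l := by decide
  exact ⟨(Conditional.Frey73.nonempty_and_cor312Of_tabulated l hl).1, fun T =>
    T.not_union_printInd2_ratPoint (by norm_num) (by norm_num) (hside l hl).2 (twentyfour_le_logQAvoid_pair' (hside l hl).1)⟩

end Frey73

end Literature.IUT.LogVolume.Cor22

end
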